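/-
Copyright (c) 2026 the pub-hodgecm-mathlib formalisation cell (harness21).  Prover seat hodgecm-mathlib-LH4-p11 (g5), req620 Track A «(D-RAM) FOUR-FRAME» squad
(unit U2H_HSide, the (ρ2b′-X) road :418; payer by lineage LH4-p14 (g4) 2026-09-04T05:05:59Z «(C1) BLOCK CENSUS IN M-LETTERS, take it by name»; dealer LH4-plan (g12) WORD #26).
-/
import Summits.HodgeConjecture.HodgeConjecture.Theorems.F0P3cDyRamBlockGlueCount          -- ★ p857501 (LH4-p07 (g6)): `#F = #axis(plane) + Σ_b Σᶠ_{B₂ ∈ S_b} #fibre`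
import Summits.HodgeConjecture.HodgeConjecture.Theorems.F0P3cDyRamConeLevelCensusWeighted  -- ★ p857411 (LH4-p12 (g4)): `Σᶠ_{S_b} g = Σ_j [lam ∈ 𝒪_j] Σᶠ_{levelSetDep} f`; brings ★ (C) p857215, ★ W4 p857271, DEFS
import Summits.HodgeConjecture.HodgeConjecture.Theorems.F0P3cDyRamConeCellNormFibre        -- ★ (LH4-p12 (g4)): per-cell `#fibre = Nat.card Sol_{2b}(r)`, `exists_map_eq_glueUnit`
import HarnessLib

/-!
# Crux `H413`, line LH4 «(D-RAM) FOUR-FRAME» — the (ρ2b′-X) road, brick (C1): THE BLOCK CENSUS IN M-LETTERS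
# `#{M self-dual ∣ Γ·M = M} = Σ_{j ≤ J} [lam ∈ 𝒪_j]·#levelSet(j, 0) + Σ_{b ∈ [1, R]} Σ_{j ≤ J} [lam ∈ 𝒪_j]·Σᶠ_{Λ ∈ levelSetDep(j, b; lam − jE u)} #Sol_{2b}(r_Λ)`

Cell `hodgecm-mathlib` (D-0151), FLOOR 0, crux item H413 = `stmt-HodgeConjecture-24833`, route of record `HCCMUnconditional`; squad F0∕P3c∕LH4; registered stub concerned:
`F0P3cDyRamFourFrameU2H.stub_U2H_fixedPointCensus_typeTwo_unit0` ((ρ2b′-X), U2H ED. 15 :418) through the payer lineage's census file (socket (C), LH4-p14 (g4)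
`SOCKET-hCensus.v1` 527a7024, brick (C1) of four).  THEOREMS ONLY (no `def`, no instance, no notation, no `sorry`, default heartbeats); lane
`--supports stmt-HodgeConjecture-24833 --as helper` (count-neutral).  DATUM-FREE: abstract valued fields `E` (the plane) and `M` (the line model), no residue field, no `|2|`, no `t`.

WHAT IS PROVED — a PURE COMPOSITION of ★ organs, no census content.  Block form `H = !![H₂ 0 0, 0, H₂ 0 1; 0, h_W, 0; H₂ 1 0, 0, H₂ 1 1]` over `E` (`σ` an isometric
involution, `|ϖ| = exp(−1)`, `H₂` hermitian with unit determinant, `|h_W| = 1`, `σ h_W = h_W`, `𝒪_E` a PID), `Γ = endoGL (γ₂, u)` UNITARY for `H`; the LINE MODEL of `(H₂, γ₂)`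
(★ `exists_lineModel`'s OUTPUT as hypotheses: `φ : E² →+ M` additive, `E`-semilinear through `jE`, bijective, `φ(γ₂x) = lam·φx`, `jE⟨x, y⟩ = hΘ(φx)φy + ρ(hΘ(φx)φy)`, with the
(M, jE, ρ, Θ, α) frame of ★ (C) p857215 ∕ ★ p857411 and the value dictionary `hjpow`, `hEval`, `hϖmax`); the fixed family finite with tube coordinates `≤ R`; `lam ∉ 𝒪_{J+1}`; the
level sets finite.  THEN for every WEIGHT `f : ℕ → ℕ → AddSubgroup M → ℕ` that AGREES WITH THE NORM-RESIDUE COUNT on the cone cells — `f b j Λ = Nat.card Sol_{2b}(r)` whenever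
`Λ = x₀·𝒪_j ∈ levelSetDep(j, b; lam − jE u)` is presented by a generator `x₀` (integral, primitive, level `b`, depth clause), `lam ∈ 𝒪_j`, and `jE r = glueUnit(x₀, b)` —
`#{M ∣ M self-dual ∧ Γ·M = M} = Σ_{j < J+1} [IsOrd (jE ϖ^j) lam]·#levelSet(j, 0) + Σ_{b ∈ Icc 1 R} Σ_{j < J+1} [IsOrd (jE ϖ^j) lam]·Σᶠ_{Λ ∈ levelSetDep(j, b; lam − jE u)} f b j Λ`.
ASSEMBLY: ★ p857501 `ncard_fixed_selfDual_endoGL_eq_axis_add_sum` (axis + cone layers through the plane) ∘ AXIS ★ (C) p857215 `ncard_selfDual_fixed_eq_ncard_orderLatt` ∘ ★ W4 p857271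
`ncard_orderLatt_selfDual_eq_sum` ∘ CONE ★ p857411 `finsum_coneWParts_eq_sum` with its `hfg` discharged per cell by ★ `ncard_glueFibre_eq_natCard_normFibre_of_gen` + ★
`exists_map_eq_glueUnit` (LH4-p12 (g4)) and the weight hypothesis.  The consumer (socket (C)'s top, LH4-p14 (g4)) instantiates `f` with ★ T1's values (`q^b` below the conductor,
`2q^b·[IsGlueNorm r]` at and above it) and the T5 tables.
HONEST LABEL.  Count-neutral lattice bookkeeping; nothing printed is asserted; (ρ2b′-X) stays OPEN; `HC_CM` is proved only modulo the 7 printed citations (2 remaining named inputs: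
hLiu418 = `stmt-HodgeConjecture-24832`, h413 = `stmt-HodgeConjecture-24833`) until rung 0 closes.

## References
* [Kottwitz1986BaseChangeUnits] R. E. Kottwitz, *Base change for unit elements of Hecke algebras*, Compositio Math. 60 (1986), §1 pp. 240–241 (orbital integrals of units as
  fixed-lattice counts), §3 pp. 247–249 (reduction to Levi blocks).
* [BruhatTits1972] F. Bruhat, J. Tits, *Groupes réductifs sur un corps local I*, Publ. Math. IHÉS 41 (1972), §10 (lattice models of the rank-one building; tube layers).
* [Jacobowitz1962] R. Jacobowitz, *Hermitian forms over local fields*, Amer. J. Math. 84 (1962), §4 (dual lattices, gluing of modular components).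
* [Flicker1998UnitaryFL] Y. Z. Flicker, *Elementary proof of the fundamental lemma for a unitary group*, Canad. J. Math. 50 (1998), p. 84 REMARK (Mars: lattices `z·R_E(j)`).
-/

set_option autoImplicit false

noncomputable section

open scoped Valued WithZero Matrix MatrixGroups
open WithZero
open scoped Classical
open Literature.NumberTheory.Automorphic Literature.NumberTheory.Automorphic.HermitianLattice Literature.NumberTheory.Automorphic.UnitaryLatticeTree
open Literature.NumberTheory.Rogawski1990
open Literature.NumberTheory.Automorphic.EllipticPlaneAsFieldLine
open Literature.NumberTheory.LocalFields.QuadraticOrder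
open Summit.HodgeConjecture.HodgeConjecture.Cruxes.H413.F0P3cDyRamToricCensusDefs
open Summit.HodgeConjecture.HodgeConjecture.Cruxes.H413.F0P3cDyRamWSideOrderCensus
open Summit.HodgeConjecture.HodgeConjecture.Cruxes.H413.F0P3cDyRamConeLevelTransport
open Summit.HodgeConjecture.HodgeConjecture.Cruxes.H413.F0P3cDyRamBlockGlueCount

namespace Summit.HodgeConjecture.HodgeConjecture.Cruxes.H413.F0P3cDyRamBlockCensusOrderForm

variable {E M : Type*} [Field E] [Valued E ℤᵐ⁰] [Field M] [Valued M ℤᵐ⁰] {ρ Θ : M →+* M} {α : M}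

/-! ## §1 The axis term in M-letters: ★ (C) p857215 ∘ ★ W4 p857271 -/

/-- **AXIS TERM IN M-LETTERS.**  `#{B₂ ∣ B₂ self-dual for H₂, γ₂·B₂ = B₂} = Σ_{j < J+1} [IsOrd (jE ϖ^j) lam]·#levelSet(j, 0)` — the `γ₂`-fixed self-dual plane lattices are carried by
the line model onto the `lam`-stable hermitian-self-dual ORDER LATTICES (★ (C) `ncard_selfDual_fixed_eq_ncard_orderLatt`), which ★ W4 `ncard_orderLatt_selfDual_eq_sum` counts one
conductor at a time. [cite: Kottwitz1986BaseChangeUnits, §1 pp. 240–241] [cite: Flicker1998UnitaryFL, p. 84 REMARK] [cite: Jacobowitz1962, §4] -/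
theorem ncard_selfDual_fixed_plane_eq_sum_levelSet_zero (σ : E →+* E) (hvσ : ∀ a, Valued.v (σ a) = Valued.v a) {ϖ : E} (hϖ : Valued.v ϖ = WithZero.exp (-1 : ℤ))
    {H₂ : Matrix (Fin 2) (Fin 2) E} (hH₂ : IsUnit H₂.det) (jE : E →+* M)
    (hρρ : ∀ x, ρ (ρ x) = x) (hvρ : ∀ x, Valued.v (ρ x) = Valued.v x) (hα : ρ α ≠ α) (hα1 : Valued.v α ≤ 1)
    (hint : ∀ z : M, Valued.v z ≤ 1 → Valued.v ((z - ρ z) / (α - ρ α)) ≤ 1)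
    (hΘΘ : ∀ x, Θ (Θ x) = x) (hΘρ : ∀ x, Θ (ρ x) = ρ (Θ x)) (hvΘ : ∀ x, Valued.v (Θ x) = Valued.v x)
    (hjv : ∀ c, Valued.v (jE c) ≤ 1 ↔ Valued.v c ≤ 1) (hjfix : ∀ z, ρ z = z ↔ ∃ c, jE c = z)
    (hjpow : ∀ (t : E) (n : ℤ), Valued.v (jE t) = Valued.v (jE ϖ) ^ n ↔ Valued.v t = Valued.v ϖ ^ n)
    (hEval : ∀ c : M, ρ c = c → c ≠ 0 → Valued.v c ≤ 1 → ∃ n : ℕ, Valued.v c = Valued.v (jE ϖ) ^ n)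
    (φ : (Fin 2 → E) →+ M) (hφs : ∀ (c : E) (x : Fin 2 → E), φ (c • x) = jE c * φ x) (hφi : Function.Injective φ) (hφo : Function.Surjective φ)
    {γ₂ : GL (Fin 2) E} {lam h : M} (hφγ : ∀ x, φ ((γ₂ : Matrix (Fin 2) (Fin 2) E).mulVec x) = lam * φ x) (hlam : Valued.v lam = 1)
    (hh : h ≠ 0) (hform : ∀ x y, jE (pairing σ H₂ x y) = h * Θ (φ x) * φ y + ρ (h * Θ (φ x) * φ y))
    {J : ℕ} (hJ : ¬ IsOrd ρ α (jE ϖ ^ (J + 1)) lam) (hfin0 : ∀ j, (levelSet ρ Θ α (jE ϖ) h j 0).Finite) :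
    {B : Submodule 𝒪[E] (Fin 2 → E) | IsSelfDualLattice σ ϖ H₂ B ∧ mapGL γ₂ B = B}.ncard =
      ∑ j ∈ Finset.range (J + 1), (if IsOrd ρ α (jE ϖ ^ j) lam then (levelSet ρ Θ α (jE ϖ) h j 0).ncard else 0) := by
  have hvϖ0 : Valued.v ϖ ≠ 0 := by rw [hϖ]; exact WithZero.exp_ne_zero
  have hϖ0 : ϖ ≠ 0 := fun h0 => by rw [h0, map_zero] at hvϖ0; exact hvϖ0 rfl
  have hϖ1 : Valued.v ϖ < 1 := by rw [hϖ, ← WithZero.exp_zero, WithZero.exp_lt_exp]; norm_num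
  have hρϖ : ρ (jE ϖ) = jE ϖ := (hjfix _).2 ⟨ϖ, rfl⟩
  have hϖE0 : jE ϖ ≠ 0 := (map_ne_zero jE).2 hϖ0
  have hϖE1 : Valued.v (jE ϖ) < 1 := by
    refine lt_of_le_of_ne ((hjv ϖ).2 hϖ1.le) fun hle => ?_
    have := (hjpow ϖ 0).1 (by rw [zpow_zero]; exact hle)
    rw [zpow_zero] at this
    exact hϖ1.ne this
  -- ★ (C): transport to the order lattices of the line model
  rw [ncard_selfDual_fixed_eq_ncard_orderLatt σ hvσ hϖ0 hϖ1.le hH₂ jE hρρ hvρ hα hα1 hint hjv hjfix φ hφs hφi hφo hφγ hlam hform]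
  -- ★ W4: the census by conductor (its set is (C)'s set with `IsOrd` folded — definitional)
  exact ncard_orderLatt_selfDual_eq_sum hρρ hvρ hα hα1 hint hΘΘ hΘρ hvΘ hρϖ hϖE0 hϖE1 hEval hh lam hJ hfin0

/-! ## §2 The cone layers in M-letters: ★ p857411 with `hfg` discharged per cell -/

/-- **CONE LAYER `b ≥ 1` IN M-LETTERS.**  For any weight `f` agreeing with the norm-residue count `Nat.card Sol_{2b}(r)` on every presented cone cell (see the module docstring),
`Σᶠ_{B₂ ∈ S_b} #fibre(ι_W B₂, b) = Σ_{j < J+1} [IsOrd (jE ϖ^j) lam]·Σᶠ_{Λ ∈ levelSetDep(j, b; lam − jE u)} f b j Λ` — ★ p857411 `finsum_coneWParts_eq_sum` with `g B₂ := #fibre`, its `hfg`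
clause supplied by ★ `ncard_glueFibre_eq_natCard_normFibre_of_gen` at a `jE`-preimage of the glue unit (★ `exists_map_eq_glueUnit`).
[cite: Kottwitz1986BaseChangeUnits, §1 pp. 240–241] [cite: BruhatTits1972, §10] [cite: Jacobowitz1962, §4] -/
theorem finsum_ncard_glueFibre_eq_sum_levelSetDep [IsPrincipalIdealRing 𝒪[E]] (σ : E →+* E) (hσ : ∀ a, σ (σ a) = a) (hvσ : ∀ a, Valued.v (σ a) = Valued.v a)
    {ϖ : E} (hϖ : Valued.v ϖ = WithZero.exp (-1 : ℤ))
    {H₂ : Matrix (Fin 2) (Fin 2) E} (hH₂ : IsUnit H₂.det) (hH₂σ : (H₂.map σ)ᵀ = H₂) {hW : E} (hhW : Valued.v hW = 1) (hhWσ : σ hW = hW) (jE : E →+* M)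
    (hρρ : ∀ x, ρ (ρ x) = x) (hvρ : ∀ x, Valued.v (ρ x) = Valued.v x) (hα : ρ α ≠ α) (hα1 : Valued.v α ≤ 1)
    (hint : ∀ z : M, Valued.v z ≤ 1 → Valued.v ((z - ρ z) / (α - ρ α)) ≤ 1)
    (hΘΘ : ∀ x, Θ (Θ x) = x) (hΘρ : ∀ x, Θ (ρ x) = ρ (Θ x)) (hvΘ : ∀ x, Valued.v (Θ x) = Valued.v x) (hΘj : ∀ x, Θ (jE x) = jE (σ x))
    (hjv : ∀ c, Valued.v (jE c) ≤ 1 ↔ Valued.v c ≤ 1) (hjfix : ∀ z, ρ z = z ↔ ∃ c, jE c = z)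
    (hjpow : ∀ (t : E) (n : ℤ), Valued.v (jE t) = Valued.v (jE ϖ) ^ n ↔ Valued.v t = Valued.v ϖ ^ n)
    (hEval : ∀ c : M, ρ c = c → c ≠ 0 → Valued.v c ≤ 1 → ∃ n : ℕ, Valued.v c = Valued.v (jE ϖ) ^ n)
    (hϖmax : ∀ t : M, ρ t = t → Valued.v t < 1 → Valued.v t ≤ Valued.v (jE ϖ))
    (φ : (Fin 2 → E) →+ M) (hφs : ∀ (c : E) (x : Fin 2 → E), φ (c • x) = jE c * φ x) (hφi : Function.Injective φ) (hφo : Function.Surjective φ)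
    {γ₂ : GL (Fin 2) E} {lam h : M} (hφγ : ∀ x, φ ((γ₂ : Matrix (Fin 2) (Fin 2) E).mulVec x) = lam * φ x) (hlam : Valued.v lam = 1)
    (hΘh : Θ h = h) (hh : h ≠ 0) (hform : ∀ x y, jE (pairing σ H₂ x y) = h * Θ (φ x) * φ y + ρ (h * Θ (φ x) * φ y))
    (u : E) (hu : Valued.v u ≤ 1) {b : ℕ} (hb : 1 ≤ b) {J : ℕ} (hJ : ¬ IsOrd ρ α (jE ϖ ^ (J + 1)) lam)
    (hfin : ∀ j, j ≤ J → (levelSet ρ Θ α (jE ϖ) h j b).Finite)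
    (f : ℕ → ℕ → AddSubgroup M → ℕ)
    (hf : ∀ (b j : ℕ) (Λ : AddSubgroup M) (x₀ : M) (r : E), 1 ≤ b → x₀ ≠ 0 →
      (∀ x, x ∈ Λ ↔ ∃ z, IsOrd ρ α (jE ϖ ^ j) z ∧ x = x₀ * z) →
      IsOrd ρ α (jE ϖ ^ j) (dualGen ρ Θ α (jE ϖ ^ j) h x₀) → ¬ IsOrd ρ α (jE ϖ ^ j) (dualGen ρ Θ α (jE ϖ ^ j) h x₀ / jE ϖ) →
      Valued.v (dualGen ρ Θ α (jE ϖ ^ j) h x₀) = Valued.v (jE ϖ) ^ b →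
      (∀ b', (∀ x ∈ Λ, Valued.v (h * Θ x * b' + ρ (h * Θ x * b')) ≤ 1) → (lam - jE u) * b' ∈ Λ) →
      IsOrd ρ α (jE ϖ ^ j) lam → jE r = glueUnit ρ Θ α (jE ϖ ^ j) h (jE ϖ) (jE hW) x₀ b →
      f b j Λ = Nat.card {x : 𝒪[E] ⧸ 𝓂[E] ^ (2 * b) // ∃ u' : 𝒪[E], Ideal.Quotient.mk (𝓂[E] ^ (2 * b)) u' = x ∧
        Valued.v ((u' : E) * σ u' - r) ≤ Valued.v (ϖ ^ (2 * b))}) :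
    ∑ᶠ B₂ ∈ {B : Submodule 𝒪[E] (Fin 2 → E) | (∃ g : GL (Fin 2) E, B = latt (g : Matrix (Fin 2) (Fin 2) E)) ∧ mapGL γ₂ B = B ∧
        ∃ w₀ : Fin 2 → E, (∀ w, w ∈ B ↔ (w ∈ dualLatt σ H₂ B ∧ Valued.v (pairing σ H₂ w₀ w) ≤ 1)) ∧
          (∀ w ∈ dualLatt σ H₂ B, ∃ (t : E) (a : Fin 2 → E), Valued.v t ≤ 1 ∧ a ∈ B ∧ w = t • w₀ + a) ∧
          Valued.v (pairing σ H₂ w₀ w₀) * Valued.v ϖ ^ (2 * b) = 1 ∧ (γ₂ : Matrix (Fin 2) (Fin 2) E).mulVec w₀ - u • w₀ ∈ B},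
        {L : Submodule 𝒪[E] (Fin 3 → E) | IsSelfDualLattice σ ϖ (!![H₂ 0 0, 0, H₂ 0 1; 0, hW, 0; H₂ 1 0, 0, H₂ 1 1] : Matrix (Fin 3) (Fin 3) E) L ∧
            L ⊓ LinearMap.ker ((LinearMap.proj (1 : Fin 3) : (Fin 3 → E) →ₗ[E] E).restrictScalars 𝒪[E]) =
              B₂.map ((Matrix.toLin' (!![1, 0; 0, 0; 0, 1] : Matrix (Fin 3) (Fin 2) E)).restrictScalars 𝒪[E]) ∧
            ∀ c : E, (Pi.single 1 c : Fin 3 → E) ∈ L ↔ Valued.v c ≤ Valued.v ϖ ^ b}.ncard =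
      ∑ j ∈ Finset.range (J + 1), (if IsOrd ρ α (jE ϖ ^ j) lam then ∑ᶠ Λ ∈ levelSetDep ρ Θ α (jE ϖ) h j b (lam - jE u), f b j Λ else 0) := by
  have hvϖ0 : Valued.v ϖ ≠ 0 := by rw [hϖ]; exact WithZero.exp_ne_zero
  have hϖ0 : ϖ ≠ 0 := fun h0 => by rw [h0, map_zero] at hvϖ0; exact hvϖ0 rfl
  have hϖ1 : Valued.v ϖ < 1 := by rw [hϖ, ← WithZero.exp_zero, WithZero.exp_lt_exp]; norm_num
  refine finsum_coneWParts_eq_sum σ hϖ0 hϖ1 H₂ jE hρρ hvρ hα hα1 hint hΘΘ hΘρ hvΘ hjv hjfix hjpow hEval hϖmax φ hφs hφi hφo hφγ hlam hΘh hh hform hu hb hJ hfin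
    _ (f b) fun j B₂ hBdep hlamj => ?_
  -- the cell over `B₂`: a presented generator of `φ(B₂)`, a `jE`-preimage of its glue unit, ★ per-cell identity, and the weight hypothesis
  obtain ⟨⟨x₀, hx₀, hΛx, hyO, hyprim, hylev⟩, hdepΛ⟩ := hBdep
  obtain ⟨r, hr⟩ := exists_map_eq_glueUnit (ρ := ρ) (Θ := Θ) (α := α) jE hρρ hΘρ hjfix (jE ϖ ^ j) h x₀ ϖ hW b
  rw [ncard_glueFibre_eq_natCard_normFibre_of_gen σ hσ hvσ hϖ hH₂ hH₂σ hhW hhWσ jE hρρ hvρ hα hα1 hint hΘΘ hΘρ hvΘ hΘj hjv hjfix hjpow hϖmax φ hφs hφi hφo hφγ hlam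
      hΘh hh hform u hb hx₀ hΛx hyO hyprim hylev hdepΛ hlamj hr,
    hf b j _ x₀ r hb hx₀ hΛx hyO hyprim hylev hdepΛ hlamj hr]

/-! ## §3 HEAD — the block census in M-letters -/

/-- **(C1) THE BLOCK CENSUS IN M-LETTERS (HEAD).**  Block form `H = !![H₂ 0 0, 0, H₂ 0 1; 0, h_W, 0; H₂ 1 0, 0, H₂ 1 1]` over `E` (`σ` an isometric involution, `|ϖ| = exp(−1)`,
`H₂` hermitian with unit determinant, `|h_W| = 1`, `σh_W = h_W`, `𝒪_E` a PID), `Γ = endoGL (γ₂, u)` UNITARY for `H`, the LINE MODEL `(M, jE, ρ, Θ, α; φ, lam, h)` of `(H₂, γ₂)` (★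
`exists_lineModel`'s output as hypotheses), the fixed self-dual family finite with tube coordinates `≤ R`, `lam ∉ 𝒪_{J+1}`, the level sets finite, and a weight `f` agreeing with
`Nat.card Sol_{2b}(r)` on every presented cone cell.  THEN
`#{M ∣ M self-dual ∧ Γ·M = M} = Σ_{j < J+1} [IsOrd (jE ϖ^j) lam]·#levelSet(j, 0) + Σ_{b ∈ Icc 1 R} Σ_{j < J+1} [IsOrd (jE ϖ^j) lam]·Σᶠ_{Λ ∈ levelSetDep(j, b; lam − jE u₀₀)} f b j Λ`
(`u₀₀ = u 0 0`).  Pure composition: ★ p857501 ∘ §1 ∘ §2. [cite: Kottwitz1986BaseChangeUnits, §1 pp. 240–241, §3 pp. 247–249] [cite: BruhatTits1972, §10] [cite: Jacobowitz1962, §4] [cite: Flicker1998UnitaryFL, p. 84 REMARK] -/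
theorem ncard_fixed_selfDual_endoGL_eq_orderForm [IsPrincipalIdealRing 𝒪[E]] (σ : E →+* E) (hσ : ∀ a, σ (σ a) = a) (hvσ : ∀ a, Valued.v (σ a) = Valued.v a)
    {ϖ : E} (hϖ : Valued.v ϖ = WithZero.exp (-1 : ℤ))
    {H₂ : Matrix (Fin 2) (Fin 2) E} (hH₂ : IsUnit H₂.det) (hH₂σ : (H₂.map σ)ᵀ = H₂) {hW : E} (hhW : Valued.v hW = 1) (hhWσ : σ hW = hW) (jE : E →+* M)
    (hρρ : ∀ x, ρ (ρ x) = x) (hvρ : ∀ x, Valued.v (ρ x) = Valued.v x) (hα : ρ α ≠ α) (hα1 : Valued.v α ≤ 1)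
    (hint : ∀ z : M, Valued.v z ≤ 1 → Valued.v ((z - ρ z) / (α - ρ α)) ≤ 1)
    (hΘΘ : ∀ x, Θ (Θ x) = x) (hΘρ : ∀ x, Θ (ρ x) = ρ (Θ x)) (hvΘ : ∀ x, Valued.v (Θ x) = Valued.v x) (hΘj : ∀ x, Θ (jE x) = jE (σ x))
    (hjv : ∀ c, Valued.v (jE c) ≤ 1 ↔ Valued.v c ≤ 1) (hjfix : ∀ z, ρ z = z ↔ ∃ c, jE c = z)
    (hjpow : ∀ (t : E) (n : ℤ), Valued.v (jE t) = Valued.v (jE ϖ) ^ n ↔ Valued.v t = Valued.v ϖ ^ n)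
    (hEval : ∀ c : M, ρ c = c → c ≠ 0 → Valued.v c ≤ 1 → ∃ n : ℕ, Valued.v c = Valued.v (jE ϖ) ^ n)
    (hϖmax : ∀ t : M, ρ t = t → Valued.v t < 1 → Valued.v t ≤ Valued.v (jE ϖ))
    (φ : (Fin 2 → E) →+ M) (hφs : ∀ (c : E) (x : Fin 2 → E), φ (c • x) = jE c * φ x) (hφi : Function.Injective φ) (hφo : Function.Surjective φ)
    {γ₂ : GL (Fin 2) E} {lam h : M} (hφγ : ∀ x, φ ((γ₂ : Matrix (Fin 2) (Fin 2) E).mulVec x) = lam * φ x) (hlam : Valued.v lam = 1)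
    (hΘh : Θ h = h) (hh : h ≠ 0) (hform : ∀ x y, jE (pairing σ H₂ x y) = h * Θ (φ x) * φ y + ρ (h * Θ (φ x) * φ y))
    (u : GL (Fin 1) E) (hΓ : endoGL (γ₂, u) ∈ unitaryGroupOfForm σ (!![H₂ 0 0, 0, H₂ 0 1; 0, hW, 0; H₂ 1 0, 0, H₂ 1 1] : Matrix (Fin 3) (Fin 3) E))
    (hu : Valued.v ((u : Matrix (Fin 1) (Fin 1) E) 0 0) = 1) {R : ℕ}
    (hfinF : {L : Submodule 𝒪[E] (Fin 3 → E) |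
      IsSelfDualLattice σ ϖ (!![H₂ 0 0, 0, H₂ 0 1; 0, hW, 0; H₂ 1 0, 0, H₂ 1 1] : Matrix (Fin 3) (Fin 3) E) L ∧ mapGL (endoGL (γ₂, u)) L = L}.Finite)
    (hR : ∀ L : Submodule 𝒪[E] (Fin 3 → E), IsSelfDualLattice σ ϖ (!![H₂ 0 0, 0, H₂ 0 1; 0, hW, 0; H₂ 1 0, 0, H₂ 1 1] : Matrix (Fin 3) (Fin 3) E) L →
      mapGL (endoGL (γ₂, u)) L = L → ∀ b : ℕ, (∀ c : E, (Pi.single 1 c : Fin 3 → E) ∈ L ↔ Valued.v c ≤ Valued.v ϖ ^ b) → b ≤ R)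
    {J : ℕ} (hJ : ¬ IsOrd ρ α (jE ϖ ^ (J + 1)) lam) (hfinLS : ∀ j a, (levelSet ρ Θ α (jE ϖ) h j a).Finite)
    (f : ℕ → ℕ → AddSubgroup M → ℕ)
    (hf : ∀ (b j : ℕ) (Λ : AddSubgroup M) (x₀ : M) (r : E), 1 ≤ b → x₀ ≠ 0 →
      (∀ x, x ∈ Λ ↔ ∃ z, IsOrd ρ α (jE ϖ ^ j) z ∧ x = x₀ * z) →
      IsOrd ρ α (jE ϖ ^ j) (dualGen ρ Θ α (jE ϖ ^ j) h x₀) → ¬ IsOrd ρ α (jE ϖ ^ j) (dualGen ρ Θ α (jE ϖ ^ j) h x₀ / jE ϖ) →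
      Valued.v (dualGen ρ Θ α (jE ϖ ^ j) h x₀) = Valued.v (jE ϖ) ^ b →
      (∀ b', (∀ x ∈ Λ, Valued.v (h * Θ x * b' + ρ (h * Θ x * b')) ≤ 1) → (lam - jE ((u : Matrix (Fin 1) (Fin 1) E) 0 0)) * b' ∈ Λ) →
      IsOrd ρ α (jE ϖ ^ j) lam → jE r = glueUnit ρ Θ α (jE ϖ ^ j) h (jE ϖ) (jE hW) x₀ b →
      f b j Λ = Nat.card {x : 𝒪[E] ⧸ 𝓂[E] ^ (2 * b) // ∃ u' : 𝒪[E], Ideal.Quotient.mk (𝓂[E] ^ (2 * b)) u' = x ∧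
        Valued.v ((u' : E) * σ u' - r) ≤ Valued.v (ϖ ^ (2 * b))}) :
    {L : Submodule 𝒪[E] (Fin 3 → E) |
        IsSelfDualLattice σ ϖ (!![H₂ 0 0, 0, H₂ 0 1; 0, hW, 0; H₂ 1 0, 0, H₂ 1 1] : Matrix (Fin 3) (Fin 3) E) L ∧ mapGL (endoGL (γ₂, u)) L = L}.ncard =
      (∑ j ∈ Finset.range (J + 1), (if IsOrd ρ α (jE ϖ ^ j) lam then (levelSet ρ Θ α (jE ϖ) h j 0).ncard else 0)) +
        ∑ b ∈ Finset.Icc 1 R, ∑ j ∈ Finset.range (J + 1),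
          (if IsOrd ρ α (jE ϖ ^ j) lam then ∑ᶠ Λ ∈ levelSetDep ρ Θ α (jE ϖ) h j b (lam - jE ((u : Matrix (Fin 1) (Fin 1) E) 0 0)), f b j Λ else 0) := by
  -- ★ p857501: axis + cone layers through the plane
  rw [ncard_fixed_selfDual_endoGL_eq_axis_add_sum σ hσ hvσ hϖ hH₂ hH₂σ hhW γ₂ u hΓ hu hfinF hR,
    -- §1: the axis in M-letters
    ncard_selfDual_fixed_plane_eq_sum_levelSet_zero σ hvσ hϖ hH₂ jE hρρ hvρ hα hα1 hint hΘΘ hΘρ hvΘ hjv hjfix hjpow hEval φ hφs hφi hφo hφγ hlam hh hform hJ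
      (fun j => hfinLS j 0)]
  -- §2: each cone layer in M-letters
  congr 1
  refine Finset.sum_congr rfl fun b hb => ?_
  exact finsum_ncard_glueFibre_eq_sum_levelSetDep σ hσ hvσ hϖ hH₂ hH₂σ hhW hhWσ jE hρρ hvρ hα hα1 hint hΘΘ hΘρ hvΘ hΘj hjv hjfix hjpow hEval hϖmax φ hφs hφi hφo hφγ hlam
    hΘh hh hform ((u : Matrix (Fin 1) (Fin 1) E) 0 0) hu.le (Finset.mem_Icc.1 hb).1 hJ (fun j _ => hfinLS j b) f hf

end Summit.HodgeConjecture.HodgeConjecture.Cruxes.H413.F0P3cDyRamBlockCensusOrderForm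

end
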